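import Summits.FinalStateConjecture.FinalStateConjecture.Theses.BartnikGapSettling
import Summits.FinalStateConjecture.FinalStateConjecture.Theorems.PhotonSphereChannelsChannelsResolveTameDevelopmentsRMinkowskiMaximal
import Summits.FinalStateConjecture.FinalStateConjecture.Theorems.BartnikGapSettlingCaptureStubMinkowskiDodgeLeaves
import HarnessLib

/-!
# Crux `BartnikGapSettling.SettledCapture` (stmt-FinalStateConjecture-17328): typed normal form,
# the Minkowski column, and the reduction to non-generic settling modulo the DODGE principle

Negative-lane helper lemmas from the crux-attack (vetting) pass of 2026-08-17
(`refuter-rattack-stmt-FinalStateConjecture-17328-0`). No Theses decl is asserted positively.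

* `LeafHyp 𝒟` — the crux's 40-binder hypothesis block ("near-sub-extremal-Kerr leaves beyond every
  compact set, for every tolerance"), written over the Literature notion
  `CauchyDevelopment.IsNearKerrLeaf`; `T2Conclusion 𝒟` — the re-typed (T2) summit settling clause for
  one development; `settledCapture_iff` — the crux is LITERALLY (`Iff.rfl`)
  `∀ admissible D, ∀ MGHD 𝒟, complete 𝓘⁺ → LeafHyp 𝒟 → T2Conclusion 𝒟`, so every kernel anchor about
  `IsNearKerrLeaf` (the DODGE: `Literature/Geometry/Lorentzian/NearKerrLeafMinkowski{Dodge,Boosted,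
  BoostedDodge}.lean`, `Theorems/BartnikGapSettlingCaptureStubMinkowskiDodgeLeaves.lean`) applies to
  this crux verbatim.
* Minkowski column (the one certified MGHD of the tree): `leafHyp_minkowski` (the hypothesis block
  holds at `Minkowski.vacuumCauchyDevelopment`, witnessed by the dodge leaves — boosted stretched
  hyperboloids, `N₀ = 0`), `t2Conclusion_minkowski` (the T2 conclusion holds there,
  `TrivialDatum.settlesT2_minkowski`), `allHyps_minkowski_of_cbg` / `allHyps_minkowski_of_mghdExists`
  (admissible datum ∧ `IsMaximal` ∧ complete `𝓘⁺` ∧ `LeafHyp` ∧ `T2Conclusion` jointly at ONE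
  development, modulo `choquetBruhat_geroch_exists_mghd_cauchy`, resp. modulo the route's own crux
  `MGHDExists`): the crux is consistent, its hypotheses are jointly satisfiable, and it is TRUE at the
  trivial datum for the right reason (`N = 0` dispersal).
* DODGE principle (inlined hypothesis `hDP`; the paper theorem of the Capture dossiers c5/a2,
  `Cruxes/Capture/Lines/*-dead.md`): the typed leaf hypothesis holds in EVERY complete-`𝓘⁺` MGHD
  (far-zone flatness + parked stretched hyperboloids); `nonGenericSettlingT2_of_settledCapture_of_dodge`
  and `not_settledCapture_of_dodge_of_not_nonGenericSettlingT2`: modulo the dodge principle the crux is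
  exactly the NON-GENERIC T2 settling clause ("every complete-𝓘⁺ MGHD of every admissible datum settles
  to sub-extremal Kerrs"), hence false as soon as one admissible datum forms an
  exactly extremal Kerr black hole with complete `𝓘⁺` (conjectured: Kehle–Unger, arXiv:2211.15742,
  arXiv:2402.10190). Repair recorded on the item: re-type the leaf block over
  `CauchyDevelopment.IsSoundNearKerrLeaf` (`Literature/Geometry/Lorentzian/SoundNearKerrLeaf.lean`).

References: Dafermos–Holzegel–Rodnianski–Taylor, arXiv:2104.08222, §1 (leaf/chart vocabulary);
Choquet-Bruhat–Geroch, CMP 14 (1969), Thm. 3; Christodoulou–Klainerman 1993, Thm. 1.0.2;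
Kehle–Unger, arXiv:2211.15742 and arXiv:2402.10190 (extremal black hole formation).
-/

set_option linter.dupNamespace false

noncomputable section

open Set
open scoped Manifold ContDiff ENNReal
open Literature.Geometry.Lorentzian

namespace Summit.FinalStateConjecture.FinalStateConjecture.Theorems.SettledCapture.Negative

open Summit.FinalStateConjecture.FinalStateConjecture.Theses

section Defs

variable {X : Type} [TopologicalSpace X] [ChartedSpace E3 X] [IsManifold (𝓡 3) ∞ X]
  [ConnectedSpace X] {D : InitialDataSet (𝓡 3) X}

/-- The hypothesis block of `SettledCapture` ("near-sub-extremal-Kerr leaves"), over the Literature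
notion `CauchyDevelopment.IsNearKerrLeaf` (definitionally the crux's inline block).
[cite: DafermosHolzegelRodnianskiTaylor2021, §1] -/
def LeafHyp (𝒟 : VacuumCauchyDevelopment D) : Prop :=
  ∃ (N₀ : ℕ) (m₀ χ : ℝ) (k₁ : ℕ) (ε₁ : ℝ≥0∞), 0 < m₀ ∧ χ < 1 ∧ 0 < ε₁ ∧
    ∀ (k : ℕ) (ε : ℝ≥0∞), 0 < ε → ∀ K : Set 𝒟.carrier, IsCompact K →
      ∃ (N : ℕ) (M a : Fin N → ℝ) (S : Set 𝒟.carrier), N ≤ N₀ ∧ (∀ i, m₀ ≤ M i ∧ M i ≤ m₀⁻¹) ∧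
        Disjoint S (𝒟.metric.causalPast 𝒟.timeOrientation K) ∧
        𝒟.toCauchyDevelopment.IsNearKerrLeaf k ε N M a S ∧
        (k₁ ≤ k → ε ≤ ε₁ → ∀ i, |a i| ≤ χ * M i)

/-- The re-typed (T2) settling conclusion for one development (verbatim the summit clause).
[cite: DafermosLuk2017, Conjecture 1] -/
def T2Conclusion (𝒟 : VacuumCauchyDevelopment D) : Prop :=
  ∃ (O : Set 𝒟.carrier) (d : FinalStateDecomposition 𝒟.toSpacetime O 2),
    (∀ i, Kerr.IsSubextremal (d.mass i) (d.spin i)) ∧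
      O = Summit.FinalStateConjecture.exteriorOf 𝒟.toCauchyDevelopment d.charted ∧
        Summit.FinalStateConjecture.RaysStayInClosure 𝒟.toCauchyDevelopment O ∧
          Summit.FinalStateConjecture.HasExhaustiveCharts d ∧
            Summit.FinalStateConjecture.IsFutureOriented d

end Defs

/-- Typed normal form of the crux, by `Iff.rfl`: the inline 40-binder leaf block IS
`CauchyDevelopment.IsNearKerrLeaf`, the conclusion IS the T2 clause. [folklore] -/
theorem settledCapture_iff :
    BartnikGapSettling.SettledCapture ↔
      ∀ (X : Type) [TopologicalSpace X] [ChartedSpace E3 X] [IsManifold (𝓡 3) ∞ X] [T2Space X]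
        [SecondCountableTopology X] [ConnectedSpace X], ∀ D ∈ admissibleVacuumData X,
        ∀ 𝒟 : VacuumCauchyDevelopment D, 𝒟.IsMaximal →
          Summit.FinalStateConjecture.HasCompleteNullInfinity 𝒟.toCauchyDevelopment →
            LeafHyp 𝒟 → T2Conclusion 𝒟 :=
  Iff.rfl

/-- Modulo the DODGE principle (hypothesis `hDP`: the typed leaf hypothesis holds in EVERY
complete-`𝓘⁺` MGHD of every admissible datum — the paper theorem of the Capture dead-line dossiers,
kernel-checked at Minkowski by `leafHyp_minkowski`) the crux yields NON-GENERIC T2 settling: every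
complete-`𝓘⁺` MGHD of every admissible datum settles down in the T2 sense (the leaf hypothesis is idle).
[folklore] -/
theorem nonGenericSettlingT2_of_settledCapture_of_dodge
    (hDP : ∀ (X : Type) [TopologicalSpace X] [ChartedSpace E3 X] [IsManifold (𝓡 3) ∞ X] [T2Space X]
      [SecondCountableTopology X] [ConnectedSpace X], ∀ D ∈ admissibleVacuumData X,
      ∀ 𝒟 : VacuumCauchyDevelopment D, 𝒟.IsMaximal →
        Summit.FinalStateConjecture.HasCompleteNullInfinity 𝒟.toCauchyDevelopment → LeafHyp 𝒟)
    (h : BartnikGapSettling.SettledCapture) :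
    ∀ (X : Type) [TopologicalSpace X] [ChartedSpace E3 X] [IsManifold (𝓡 3) ∞ X] [T2Space X]
      [SecondCountableTopology X] [ConnectedSpace X], ∀ D ∈ admissibleVacuumData X,
      ∀ 𝒟 : VacuumCauchyDevelopment D, 𝒟.IsMaximal →
        Summit.FinalStateConjecture.HasCompleteNullInfinity 𝒟.toCauchyDevelopment → T2Conclusion 𝒟 :=
  fun X _ _ _ _ _ _ D hD 𝒟 hmax hscri => h X D hD 𝒟 hmax hscri (hDP X D hD 𝒟 hmax hscri)

/-- Hence any failure of non-generic T2 settling (hypothesis `hN`; e.g. an admissible datum forming an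
exactly extremal Kerr black hole with complete `𝓘⁺`, conjectured by Kehle–Unger) refutes the crux,
GIVEN the dodge principle `hDP`. [cite: KehleUnger2025] -/
theorem not_settledCapture_of_dodge_of_not_nonGenericSettlingT2
    (hDP : ∀ (X : Type) [TopologicalSpace X] [ChartedSpace E3 X] [IsManifold (𝓡 3) ∞ X] [T2Space X]
      [SecondCountableTopology X] [ConnectedSpace X], ∀ D ∈ admissibleVacuumData X,
      ∀ 𝒟 : VacuumCauchyDevelopment D, 𝒟.IsMaximal →
        Summit.FinalStateConjecture.HasCompleteNullInfinity 𝒟.toCauchyDevelopment → LeafHyp 𝒟)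
    (hN : ¬ ∀ (X : Type) [TopologicalSpace X] [ChartedSpace E3 X] [IsManifold (𝓡 3) ∞ X] [T2Space X]
      [SecondCountableTopology X] [ConnectedSpace X], ∀ D ∈ admissibleVacuumData X,
      ∀ 𝒟 : VacuumCauchyDevelopment D, 𝒟.IsMaximal →
        Summit.FinalStateConjecture.HasCompleteNullInfinity 𝒟.toCauchyDevelopment → T2Conclusion 𝒟) :
    ¬ BartnikGapSettling.SettledCapture :=
  fun h => hN (nonGenericSettlingT2_of_settledCapture_of_dodge hDP h)

/-! ### The Minkowski column -/

open Literature.Geometry.Lorentzian.Minkowski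
open Summit.FinalStateConjecture.FinalStateConjecture.Theorems

/-- The leaf hypothesis holds at the Minkowski development (`N₀ = 0`, `m₀ = 1`, `χ = 0`, `k₁ = 0`,
`ε₁ = ⊤`; leaves = the boosted stretched hyperboloids of `stub_minkowskiDodgeLeaves`).
[cite: ONeillSemiRiemannian1983, Ch. 14, p. 402] -/
theorem leafHyp_minkowski : LeafHyp Minkowski.vacuumCauchyDevelopment := by
  refine ⟨0, 1, 0, 0, ⊤, one_pos, zero_lt_one, ENNReal.zero_lt_top, fun k ε hε K hK => ?_⟩
  obtain ⟨S, hdisj, hleaf, -⟩ :=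
    BartnikGapSettling.Capture.stub_minkowskiDodgeLeaves k ε hε K hK 0 0
  exact ⟨0, ![], ![], S, le_rfl, fun i => i.elim0, hdisj, hleaf, fun _ _ i => i.elim0⟩

/-- The T2 conclusion holds at the Minkowski development (honest `N = 0` decomposition).
[cite: ChristodoulouKlainerman1993, Thm. 1.0.2] -/
theorem t2Conclusion_minkowski : T2Conclusion Minkowski.vacuumCauchyDevelopment :=
  ChannelsResolveTameDevelopmentsR.TrivialDatum.settlesT2_minkowski.2

/-- The body of the crux holds at the Minkowski development outright (its conclusion is true there).
[cite: ChristodoulouKlainerman1993, Thm. 1.0.2] -/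
theorem settledCapture_body_minkowski :
    Minkowski.vacuumCauchyDevelopment.IsMaximal →
      Summit.FinalStateConjecture.HasCompleteNullInfinity
          Minkowski.vacuumCauchyDevelopment.toCauchyDevelopment →
        LeafHyp Minkowski.vacuumCauchyDevelopment → T2Conclusion Minkowski.vacuumCauchyDevelopment :=
  fun _ _ _ => t2Conclusion_minkowski

/-- Anti-vacuity modulo the named fact `choquetBruhat_geroch_exists_mghd_cauchy` (CBG 1969, Thm. 3):
admissible datum, `IsMaximal`, complete `𝓘⁺`, the leaf hypothesis AND the T2 conclusion hold together
at ONE development. [cite: ChoquetBruhatGeroch1969CMP, Thm. 3] -/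
theorem allHyps_minkowski_of_cbg (hcbg : choquetBruhat_geroch_exists_mghd_cauchy) :
    trivialData ∈ admissibleVacuumData Minkowski.slice ∧
      Minkowski.vacuumCauchyDevelopment.IsMaximal ∧
        Summit.FinalStateConjecture.HasCompleteNullInfinity
            Minkowski.vacuumCauchyDevelopment.toCauchyDevelopment ∧
          LeafHyp Minkowski.vacuumCauchyDevelopment ∧ T2Conclusion Minkowski.vacuumCauchyDevelopment :=
  ⟨trivialData_mem_admissibleVacuumData, Minkowski.isMaximal_vacuumCauchyDevelopment hcbg,
    WeakCosmicCensorshipMGHD.Negative.minkowski_hasCompleteNullInfinity, leafHyp_minkowski,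
    t2Conclusion_minkowski⟩

/-- The same anti-vacuity modulo the route's own crux `MGHDExists` (stmt-FinalStateConjecture-9937),
via `Minkowski.isMaximal_vacuumCauchyDevelopment_iff`. [cite: ChoquetBruhatGeroch1969CMP, Thm. 3] -/
theorem allHyps_minkowski_of_mghdExists (h : BartnikGapSettling.MGHDExists) :
    trivialData ∈ admissibleVacuumData Minkowski.slice ∧
      Minkowski.vacuumCauchyDevelopment.IsMaximal ∧
        Summit.FinalStateConjecture.HasCompleteNullInfinity
            Minkowski.vacuumCauchyDevelopment.toCauchyDevelopment ∧
          LeafHyp Minkowski.vacuumCauchyDevelopment ∧ T2Conclusion Minkowski.vacuumCauchyDevelopment :=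
  ⟨trivialData_mem_admissibleVacuumData,
    Minkowski.isMaximal_vacuumCauchyDevelopment_iff.2
      (h Minkowski.slice trivialData trivialData_mem_admissibleVacuumData),
    WeakCosmicCensorshipMGHD.Negative.minkowski_hasCompleteNullInfinity, leafHyp_minkowski,
    t2Conclusion_minkowski⟩

end Summit.FinalStateConjecture.FinalStateConjecture.Theorems.SettledCapture.Negative

end
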